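import Mathlib
import Summits.NavierStokesRegularity.NavierStokesRegularity.Theorems.AxisTwistDoorTiltDominationLocFluxNondecay
import Summits.NavierStokesRegularity.NavierStokesRegularity.Theorems.AxisTwistDoorSignConeInterior
import HarnessLib

/-!
# AxisTwistDoor · crux `TiltDominationLoc` (stmt-NavierStokesRegularity-26991, wall W3) · line `signcone` — THE BISECTOR
# FRAME: two independent one-signed directions are a FLANKED `e₃` after a rotation, so the dihedral / wedge counterexample
# has NON-DECAYING BISECTOR FLUX (unconditionally)

Helper file of the LEAD (ns-atd-p1 g5; `--supports stmt-NavierStokesRegularity-26991 --as helper`).  No definitions.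

The residue rung `StubProperWedgeRigiditySat` of line `signcone` (and the birth rung `StubDihedralRigidity`) concern a
Type-I ancient Oseen-mild profile `w` with TWO linearly independent one-signed vorticity directions: `⟪ω, e₃⟫ ≥ 0` and
`⟪ω, e⟫ ≥ 0` with `e ∉ ℝe₃`.  Normalise `b = e/‖e‖` and let `m = e₃ + b` (the BISECTOR, `≠ 0` since `b ≠ −e₃`) and
`d = e₃ − b` (`≠ 0`, `⟪m, d⟫ = 0`).  For ANY determinant-one linear isometry `L` of `ℝ³` with `L⁻¹e₃ = m/‖m‖` the
conjugated profile `w'(t,x) = L w(t, L⁻¹x)` — again in the class, backward-singular at the apex iff `w` is — is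
FLANKED: with the horizontal vector `h' = ‖m‖⁻¹ L d ≠ 0` one has `⟪ω', e₃ + h'⟫ = 2‖m‖⁻¹⟪ω, e₃⟫∘L⁻¹ ≥ 0` and
`⟪ω', e₃ − h'⟫ = 2‖m‖⁻¹⟪ω, b⟫∘L⁻¹ ≥ 0` (pseudovector law `⟪curl w'(y), L a⟫ = det L · ⟪curl w(L⁻¹y), a⟫`,
`Literature.Analysis.FluidPDE.inner_curl_conj_linearIsometryEquiv`).  Hence, by the LEAD's
`…TiltDominationLocFluxNondecay.not_isBackwardSingularPoint_of_fluxDecay_of_flank_core` (Lei–Ren–Tian's final step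
without a cone + Barker–Prange):

* `flank_in_bisectorFrame` — the flank structure of `w'` (pure covariance);
* `exists_bisectorFrame` — such an `L` exists (`…exists_linearIsometryEquiv_det_one_symm_single_two`);
* `not_isBackwardSingularPoint_of_fluxDecay_bisectorFrame` — **DIHEDRAL RIGIDITY ⟸ BISECTOR-FLUX DECAY**, with no W4
  and no saturation: if in some (any) bisector frame the apex flux `Γ_{w'}(r,z,s) = ∮_{S(r,z)} w'(s)·e_θ dl` of the
  conjugated profile decays (`FluxDecay w'`), the apex of `w` is NOT backward-singular;
* `exists_flux_lower_bound_bisectorFrame_of_singular` — contrapositive: the counterexample of the dihedral / proper-wedge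
  rung (two independent one-signed directions, backward-singular apex) carries, in a bisector frame, axis circulation
  `Γ_{w'} ≥ κ > 0` on some circle of EVERY apex window `{−ρ² < s < 0, 0 < r < ρ, |z| < ρ}`.

So the open content of `StubProperWedgeRigiditySat` is exactly FLUX DECAY OF THE BISECTOR COMPONENT at the apex — the
same statement as W3-mod-W4 for the ray cone (`…FluxNondecay`), now with the in-plane cone `|⟪ω', h'⟫| ≤ ω'₃` in hand
and only the spine component `⟪ω', e₃ × h'⟫` free (two-signed at all scales under saturation).
HONEST FRAMING: statements about HYPOTHETICAL Type-I blow-up profiles; the rungs, W3 (26991), W4, W6, the leaf and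
Navier–Stokes regularity (Clay A) are OPEN; nothing here is an NS regularity statement.
[cite: LeiRenTian2025, §4 p. 12 and Rem. 1.2 (rotation to the axis)] [cite: ArfkenWeber1995, §2.9 (pseudovector law)]
[cite: BarkerPrange2020Alignment, Prop. 4 and Remark 5]
-/

noncomputable section

-- the summit and its single sub-problem share the name (CONVENTIONS §1), as in every Theorems file
set_option linter.dupNamespace false

namespace Summit.NavierStokesRegularity.NavierStokesRegularity.Theorems.AxisTwistDoorSignConeBisectorFrame

open scoped Topology InnerProductSpace RealInnerProductSpace
open Set Function MeasureTheory Filter Metric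
open Literature.Analysis
open Literature.Analysis.FluidPDE hiding eR
open Summit.NavierStokesRegularity.NavierStokesRegularity.Theorems
open Summit.NavierStokesRegularity.NavierStokesRegularity.Theorems.AxisTwistDoorAveragedConeLiouvilleDefs (circ FluxDecay)
open Summit.NavierStokesRegularity.NavierStokesRegularity.Theorems.AxisTwistDoorTiltDominationLocFluxNondecay
  (not_isBackwardSingularPoint_of_fluxDecay_of_flank_core)
open Summit.NavierStokesRegularity.NavierStokesRegularity.Theorems.HalfSpaceWindowDoorCirculationCarryingRigidityRotate
  (exists_linearIsometryEquiv_det_one_symm_single_two)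
open Summit.NavierStokesRegularity.NavierStokesRegularity.Theorems.PoloidalWindowDoorPoloidalWindowRigidityRotate
  (class_conj_linearIsometryEquiv)
open Summit.NavierStokesRegularity.NavierStokesRegularity.Theorems.RellichScarSimilarityCovariance
  (LIE.isBackwardSingularPoint_zero_conj)

variable {C : ℝ} {w : ℝ → EuclideanSpace ℝ (Fin 3) → EuclideanSpace ℝ (Fin 3)} {e : EuclideanSpace ℝ (Fin 3)}

/-! ### §1 Linear algebra of the bisector -/

/-- For `e ∉ ℝe₃` (in particular `e ≠ 0`): the bisector `m = e₃ + e/‖e‖` is non-zero. -/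
theorem bisector_ne_zero (hline : ∀ c : ℝ, e ≠ c • (EuclideanSpace.single (2 : Fin 3) (1 : ℝ) : EuclideanSpace ℝ (Fin 3))) : (EuclideanSpace.single (2 : Fin 3) (1 : ℝ) : EuclideanSpace ℝ (Fin 3)) + (‖e‖⁻¹ : ℝ) • e ≠ 0 := by
  have he : e ≠ 0 := fun h0 => hline 0 (by rw [h0, zero_smul])
  have hn : 0 < ‖e‖ := norm_pos_iff.2 he
  intro h0
  apply hline (-‖e‖)
  have h1 : (‖e‖⁻¹ : ℝ) • e = -(EuclideanSpace.single (2 : Fin 3) (1 : ℝ) : EuclideanSpace ℝ (Fin 3)) := eq_neg_of_add_eq_zero_right h0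
  calc e = ‖e‖ • ((‖e‖⁻¹ : ℝ) • e) := by rw [smul_smul, mul_inv_cancel₀ hn.ne', one_smul]
    _ = ‖e‖ • (-(EuclideanSpace.single (2 : Fin 3) (1 : ℝ) : EuclideanSpace ℝ (Fin 3))) := by rw [h1]
    _ = (-‖e‖) • (EuclideanSpace.single (2 : Fin 3) (1 : ℝ) : EuclideanSpace ℝ (Fin 3)) := by rw [smul_neg, neg_smul]

/-- For `e ∉ ℝe₃`: the co-bisector `d = e₃ − e/‖e‖` is non-zero. -/
theorem cobisector_ne_zero (hline : ∀ c : ℝ, e ≠ c • (EuclideanSpace.single (2 : Fin 3) (1 : ℝ) : EuclideanSpace ℝ (Fin 3))) : (EuclideanSpace.single (2 : Fin 3) (1 : ℝ) : EuclideanSpace ℝ (Fin 3)) - (‖e‖⁻¹ : ℝ) • e ≠ 0 := by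
  have he : e ≠ 0 := fun h0 => hline 0 (by rw [h0, zero_smul])
  have hn : 0 < ‖e‖ := norm_pos_iff.2 he
  intro h0
  apply hline ‖e‖
  have h1 : (‖e‖⁻¹ : ℝ) • e = (EuclideanSpace.single (2 : Fin 3) (1 : ℝ) : EuclideanSpace ℝ (Fin 3)) := (sub_eq_zero.1 h0).symm
  calc e = ‖e‖ • ((‖e‖⁻¹ : ℝ) • e) := by rw [smul_smul, mul_inv_cancel₀ hn.ne', one_smul]
    _ = ‖e‖ • (EuclideanSpace.single (2 : Fin 3) (1 : ℝ) : EuclideanSpace ℝ (Fin 3)) := by rw [h1]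

/-- The bisector and the co-bisector of two UNIT vectors are orthogonal: `⟪e₃ + b, e₃ − b⟫ = ‖e₃‖² − ‖b‖² = 0`. -/
theorem inner_bisector_cobisector (he : e ≠ 0) :
    ⟪(EuclideanSpace.single (2 : Fin 3) (1 : ℝ) : EuclideanSpace ℝ (Fin 3)) + (‖e‖⁻¹ : ℝ) • e, (EuclideanSpace.single (2 : Fin 3) (1 : ℝ) : EuclideanSpace ℝ (Fin 3)) - (‖e‖⁻¹ : ℝ) • e⟫_ℝ = 0 := by
  have hn : 0 < ‖e‖ := norm_pos_iff.2 he
  have hb : ‖(‖e‖⁻¹ : ℝ) • e‖ = 1 := by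
    rw [norm_smul, Real.norm_of_nonneg (inv_nonneg.2 hn.le), inv_mul_cancel₀ hn.ne']
  have h3 : ‖(EuclideanSpace.single (2 : Fin 3) (1 : ℝ) : EuclideanSpace ℝ (Fin 3))‖ = 1 := by simp
  rw [inner_add_left, inner_sub_right, inner_sub_right, real_inner_self_eq_norm_sq, real_inner_self_eq_norm_sq,
    h3, hb, real_inner_comm]
  ring

/-! ### §2 The flank structure in a bisector frame -/

/-- **Two independent one-signed directions are a flanked `e₃` in any bisector frame.**  Let `⟪curl w(s) y, e₃⟫ ≥ 0` and
`⟪curl w(s) y, e⟫ ≥ 0` everywhere (`s < 0`) with `e ∉ ℝe₃`, and let `L` be a determinant-one linear isometry with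
`L⁻¹e₃ = m/‖m‖`, `m = e₃ + e/‖e‖`.  Then for the conjugated profile `w'(t,x) = L w(t, L⁻¹x)` there is a horizontal
`h' ≠ 0` (namely `‖m‖⁻¹ L(e₃ − e/‖e‖)`) with `⟪curl w'(s) y, e₃ + h'⟫ ≥ 0` and `⟪curl w'(s) y, e₃ − h'⟫ ≥ 0` everywhere.
[cite: ArfkenWeber1995, §2.9 eq. (2.90), (2.97)–(2.99) (pseudovector law)] -/
theorem flank_in_bisectorFrame (he3 : ∀ s < (0 : ℝ), ∀ y, 0 ≤ ⟪curl (w s) y, (EuclideanSpace.single (2 : Fin 3) (1 : ℝ) : EuclideanSpace ℝ (Fin 3))⟫_ℝ)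
    (he : ∀ s < (0 : ℝ), ∀ y, 0 ≤ ⟪curl (w s) y, e⟫_ℝ) (hline : ∀ c : ℝ, e ≠ c • (EuclideanSpace.single (2 : Fin 3) (1 : ℝ) : EuclideanSpace ℝ (Fin 3)))
    (L : EuclideanSpace ℝ (Fin 3) ≃ₗᵢ[ℝ] EuclideanSpace ℝ (Fin 3))
    (hdet : (L : EuclideanSpace ℝ (Fin 3) →L[ℝ] EuclideanSpace ℝ (Fin 3)).det = 1)
    (hL : L.symm (EuclideanSpace.single (2 : Fin 3) (1 : ℝ) : EuclideanSpace ℝ (Fin 3)) = (‖(EuclideanSpace.single (2 : Fin 3) (1 : ℝ) : EuclideanSpace ℝ (Fin 3)) + (‖e‖⁻¹ : ℝ) • e‖⁻¹ : ℝ) • ((EuclideanSpace.single (2 : Fin 3) (1 : ℝ) : EuclideanSpace ℝ (Fin 3)) + (‖e‖⁻¹ : ℝ) • e)) :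
    ∃ h' : EuclideanSpace ℝ (Fin 3), h' ≠ 0 ∧ h' 2 = 0 ∧
      (∀ s < (0 : ℝ), ∀ y, 0 ≤ ⟪curl (fun x => L (w s (L.symm x))) y, (EuclideanSpace.single (2 : Fin 3) (1 : ℝ) : EuclideanSpace ℝ (Fin 3)) + h'⟫_ℝ) ∧
      (∀ s < (0 : ℝ), ∀ y, 0 ≤ ⟪curl (fun x => L (w s (L.symm x))) y, (EuclideanSpace.single (2 : Fin 3) (1 : ℝ) : EuclideanSpace ℝ (Fin 3)) - h'⟫_ℝ) := by
  have he0 : e ≠ 0 := fun h0 => hline 0 (by rw [h0, zero_smul])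
  have hn : 0 < ‖e‖ := norm_pos_iff.2 he0
  set b : EuclideanSpace ℝ (Fin 3) := (‖e‖⁻¹ : ℝ) • e with hb
  set m : EuclideanSpace ℝ (Fin 3) := (EuclideanSpace.single (2 : Fin 3) (1 : ℝ) : EuclideanSpace ℝ (Fin 3)) + b with hm
  set d : EuclideanSpace ℝ (Fin 3) := (EuclideanSpace.single (2 : Fin 3) (1 : ℝ) : EuclideanSpace ℝ (Fin 3)) - b with hd
  have hm0 : m ≠ 0 := bisector_ne_zero hline
  have hd0 : d ≠ 0 := cobisector_ne_zero hline
  have hmn : 0 < ‖m‖ := norm_pos_iff.2 hm0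
  have hmd : ⟪m, d⟫_ℝ = 0 := inner_bisector_cobisector he0
  clear_value b m d
  -- `e₃ = ‖m‖⁻¹ L m`
  have he3L : (EuclideanSpace.single (2 : Fin 3) (1 : ℝ) : EuclideanSpace ℝ (Fin 3)) = (‖m‖⁻¹ : ℝ) • L m := by
    have h1 := congrArg L hL
    rw [LinearIsometryEquiv.apply_symm_apply, map_smul] at h1
    exact h1
  refine ⟨(‖m‖⁻¹ : ℝ) • L d, ?_, ?_, ?_, ?_⟩
  · -- non-zero
    intro h0
    rw [smul_eq_zero] at h0
    rcases h0 with h0 | h0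
    · exact (inv_ne_zero hmn.ne') h0
    · exact hd0 ((LinearIsometryEquiv.map_eq_zero_iff L).1 h0)
  · -- horizontal: `⟪L d, e₃⟫ = ⟪L d, ‖m‖⁻¹ L m⟫ = ‖m‖⁻¹⟪d, m⟫ = 0`
    have h2 : ((‖m‖⁻¹ : ℝ) • L d) 2 = ⟪(‖m‖⁻¹ : ℝ) • L d, (EuclideanSpace.single (2 : Fin 3) (1 : ℝ) : EuclideanSpace ℝ (Fin 3))⟫_ℝ := by
      rw [EuclideanSpace.inner_single_right]; simp
    rw [h2, he3L, real_inner_smul_left, real_inner_smul_right, LinearIsometryEquiv.inner_map_map, real_inner_comm, hmd]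
    ring
  · -- `e₃ + h' = ‖m‖⁻¹ L (m + d) = 2‖m‖⁻¹ L e₃`
    intro s hs y
    have hmd2 : m + d = (2 : ℝ) • (EuclideanSpace.single (2 : Fin 3) (1 : ℝ) : EuclideanSpace ℝ (Fin 3)) := by rw [hm, hd, two_smul]; abel
    have hsum : (EuclideanSpace.single (2 : Fin 3) (1 : ℝ) : EuclideanSpace ℝ (Fin 3)) + (‖m‖⁻¹ : ℝ) • L d = (2 * ‖m‖⁻¹ : ℝ) • L (EuclideanSpace.single (2 : Fin 3) (1 : ℝ) : EuclideanSpace ℝ (Fin 3)) := by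
      calc (EuclideanSpace.single (2 : Fin 3) (1 : ℝ) : EuclideanSpace ℝ (Fin 3)) + (‖m‖⁻¹ : ℝ) • L d = (‖m‖⁻¹ : ℝ) • L m + (‖m‖⁻¹ : ℝ) • L d := by rw [← he3L]
        _ = (‖m‖⁻¹ : ℝ) • L (m + d) := by rw [map_add, smul_add]
        _ = (‖m‖⁻¹ : ℝ) • L ((2 : ℝ) • (EuclideanSpace.single (2 : Fin 3) (1 : ℝ) : EuclideanSpace ℝ (Fin 3))) := by rw [hmd2]
        _ = (2 * ‖m‖⁻¹ : ℝ) • L (EuclideanSpace.single (2 : Fin 3) (1 : ℝ) : EuclideanSpace ℝ (Fin 3)) := by rw [map_smul, smul_smul, mul_comm]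
    rw [hsum, real_inner_smul_right, inner_curl_conj_linearIsometryEquiv, hdet, one_mul]
    exact mul_nonneg (by positivity) (he3 s hs _)
  · -- `e₃ − h' = ‖m‖⁻¹ L (m − d) = 2‖m‖⁻¹ L b`
    intro s hs y
    have hmd2 : m - d = (2 * ‖e‖⁻¹ : ℝ) • e := by rw [hm, hd, hb, mul_smul, two_smul]; abel
    have hdiff : (EuclideanSpace.single (2 : Fin 3) (1 : ℝ) : EuclideanSpace ℝ (Fin 3)) - (‖m‖⁻¹ : ℝ) • L d = (2 * ‖m‖⁻¹ * ‖e‖⁻¹ : ℝ) • L e := by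
      calc (EuclideanSpace.single (2 : Fin 3) (1 : ℝ) : EuclideanSpace ℝ (Fin 3)) - (‖m‖⁻¹ : ℝ) • L d = (‖m‖⁻¹ : ℝ) • L m - (‖m‖⁻¹ : ℝ) • L d := by rw [← he3L]
        _ = (‖m‖⁻¹ : ℝ) • L (m - d) := by rw [map_sub, smul_sub]
        _ = (‖m‖⁻¹ : ℝ) • L ((2 * ‖e‖⁻¹ : ℝ) • e) := by rw [hmd2]
        _ = (2 * ‖m‖⁻¹ * ‖e‖⁻¹ : ℝ) • L e := by rw [map_smul, smul_smul]; congr 1; ring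
    rw [hdiff, real_inner_smul_right, inner_curl_conj_linearIsometryEquiv, hdet, one_mul]
    exact mul_nonneg (by positivity) (he s hs _)

/-- **A bisector frame exists**: for `e ∉ ℝe₃` there is a determinant-one linear isometry `L` of `ℝ³` with
`L⁻¹e₃ = m/‖m‖`, `m = e₃ + e/‖e‖`. -/
theorem exists_bisectorFrame (hline : ∀ c : ℝ, e ≠ c • (EuclideanSpace.single (2 : Fin 3) (1 : ℝ) : EuclideanSpace ℝ (Fin 3))) :
    ∃ L : EuclideanSpace ℝ (Fin 3) ≃ₗᵢ[ℝ] EuclideanSpace ℝ (Fin 3),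
      L.symm (EuclideanSpace.single (2 : Fin 3) (1 : ℝ) : EuclideanSpace ℝ (Fin 3)) = (‖(EuclideanSpace.single (2 : Fin 3) (1 : ℝ) : EuclideanSpace ℝ (Fin 3)) + (‖e‖⁻¹ : ℝ) • e‖⁻¹ : ℝ) • ((EuclideanSpace.single (2 : Fin 3) (1 : ℝ) : EuclideanSpace ℝ (Fin 3)) + (‖e‖⁻¹ : ℝ) • e) ∧
      (L : EuclideanSpace ℝ (Fin 3) →L[ℝ] EuclideanSpace ℝ (Fin 3)).det = 1 :=
  exists_linearIsometryEquiv_det_one_symm_single_two (bisector_ne_zero hline)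

/-! ### §3 Dihedral rigidity from bisector-flux decay; the counterexample's bisector flux does not decay -/

/-- **DIHEDRAL RIGIDITY ⟸ BISECTOR-FLUX DECAY** (no W4, no saturation).  Let `w` be a Type-I ancient Oseen-mild profile
(rate, continuity on the open slab, Oseen identity, divergence-free slices) with two independent one-signed vorticity
directions `e₃` and `e ∉ ℝe₃`, and let `L` be any bisector frame (`det L = 1`, `L⁻¹e₃ = m/‖m‖`).  If the apex flux of
the conjugated profile `w' = L ∘ w ∘ L⁻¹` decays — `FluxDecay w'`: `sup_{𝒬(ρ)} Γ_{w'} → 0`, `Γ_{w'}(r,z,s)` the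
circulation of `w'(s)` about the circle of radius `r` at height `z` around the vertical axis, i.e. the flux of the
BISECTOR component of `ω` through discs normal to the bisector — then the apex of `w` is NOT backward-singular.
(Class and apex singularity are covariant, `class_conj_linearIsometryEquiv` / `LIE.isBackwardSingularPoint_zero_conj`;
`w'` is flanked by §2; conclude with `…FluxNondecay.not_isBackwardSingularPoint_of_fluxDecay_of_flank_core`.)
[cite: LeiRenTian2025, §4 p. 12 and Rem. 1.2; BarkerPrange2020Alignment, Prop. 4 and Remark 5] -/
theorem not_isBackwardSingularPoint_of_fluxDecay_bisectorFrame (hrate : HasTypeITimeDecay C w)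
    (hcont : ContinuousOn (uncurry w) (Iio (0 : ℝ) ×ˢ univ))
    (hmild : ∀ s t : ℝ, s < t → t < 0 → ∀ x,
      w t x = UnboundedOperators.heatExtension (w s) (t - s) x - oseenDuhamel 1 s w w t x)
    (hdiv : ∀ t < 0, VectorCalculus.IsDivFree (w t))
    (he3 : ∀ s < (0 : ℝ), ∀ y, 0 ≤ ⟪curl (w s) y, (EuclideanSpace.single (2 : Fin 3) (1 : ℝ) : EuclideanSpace ℝ (Fin 3))⟫_ℝ)
    (he : ∀ s < (0 : ℝ), ∀ y, 0 ≤ ⟪curl (w s) y, e⟫_ℝ) (hline : ∀ c : ℝ, e ≠ c • (EuclideanSpace.single (2 : Fin 3) (1 : ℝ) : EuclideanSpace ℝ (Fin 3)))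
    (L : EuclideanSpace ℝ (Fin 3) ≃ₗᵢ[ℝ] EuclideanSpace ℝ (Fin 3))
    (hdet : (L : EuclideanSpace ℝ (Fin 3) →L[ℝ] EuclideanSpace ℝ (Fin 3)).det = 1)
    (hL : L.symm (EuclideanSpace.single (2 : Fin 3) (1 : ℝ) : EuclideanSpace ℝ (Fin 3)) = (‖(EuclideanSpace.single (2 : Fin 3) (1 : ℝ) : EuclideanSpace ℝ (Fin 3)) + (‖e‖⁻¹ : ℝ) • e‖⁻¹ : ℝ) • ((EuclideanSpace.single (2 : Fin 3) (1 : ℝ) : EuclideanSpace ℝ (Fin 3)) + (‖e‖⁻¹ : ℝ) • e))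
    (hflux : FluxDecay (fun t x => L (w t (L.symm x)))) :
    ¬ IsBackwardSingularPoint w 0 := by
  intro hsing
  obtain ⟨hrate', hcont', hmild', hdiv'⟩ := class_conj_linearIsometryEquiv L hrate hcont hmild hdiv
  have hsing' := LIE.isBackwardSingularPoint_zero_conj L hsing
  obtain ⟨h', hh', hh'3, hplus, hminus⟩ := flank_in_bisectorFrame he3 he hline L hdet hL
  exact not_isBackwardSingularPoint_of_fluxDecay_of_flank_core hrate' hcont' hmild' hdiv' hh' hh'3 hplus hminus hflux
    hsing'

/-- **THE DIHEDRAL / WEDGE COUNTEREXAMPLE HAS NON-DECAYING BISECTOR FLUX.**  A Type-I ancient Oseen-mild profile with two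
independent one-signed vorticity directions `e₃`, `e ∉ ℝe₃` which IS backward-singular at the apex — the hypothetical
counterexample to the rungs `StubDihedralRigidity` / `StubProperWedgeRigiditySat` of line `signcone` — has a bisector
frame `L` (`det L = 1`, `L⁻¹e₃ = m/‖m‖`) in which its axis circulation is bounded below at all scales: some `κ > 0`
and, in every apex window `{−ρ² < s < 0, 0 < r < ρ, |z| < ρ}`, a circle with `Γ_{L∘w∘L⁻¹}(r,z,s) ≥ κ`.
[cite: LeiRenTian2025, §4 eq. (Gamma-decay)/(kappa), p. 11] -/
theorem exists_flux_lower_bound_bisectorFrame_of_singular (hrate : HasTypeITimeDecay C w)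
    (hcont : ContinuousOn (uncurry w) (Iio (0 : ℝ) ×ˢ univ))
    (hmild : ∀ s t : ℝ, s < t → t < 0 → ∀ x,
      w t x = UnboundedOperators.heatExtension (w s) (t - s) x - oseenDuhamel 1 s w w t x)
    (hdiv : ∀ t < 0, VectorCalculus.IsDivFree (w t))
    (he3 : ∀ s < (0 : ℝ), ∀ y, 0 ≤ ⟪curl (w s) y, (EuclideanSpace.single (2 : Fin 3) (1 : ℝ) : EuclideanSpace ℝ (Fin 3))⟫_ℝ)
    (he : ∀ s < (0 : ℝ), ∀ y, 0 ≤ ⟪curl (w s) y, e⟫_ℝ) (hline : ∀ c : ℝ, e ≠ c • (EuclideanSpace.single (2 : Fin 3) (1 : ℝ) : EuclideanSpace ℝ (Fin 3)))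
    (hsing : IsBackwardSingularPoint w 0) :
    ∃ L : EuclideanSpace ℝ (Fin 3) ≃ₗᵢ[ℝ] EuclideanSpace ℝ (Fin 3),
      (L : EuclideanSpace ℝ (Fin 3) →L[ℝ] EuclideanSpace ℝ (Fin 3)).det = 1 ∧
      L.symm (EuclideanSpace.single (2 : Fin 3) (1 : ℝ) : EuclideanSpace ℝ (Fin 3)) = (‖(EuclideanSpace.single (2 : Fin 3) (1 : ℝ) : EuclideanSpace ℝ (Fin 3)) + (‖e‖⁻¹ : ℝ) • e‖⁻¹ : ℝ) • ((EuclideanSpace.single (2 : Fin 3) (1 : ℝ) : EuclideanSpace ℝ (Fin 3)) + (‖e‖⁻¹ : ℝ) • e) ∧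
      ∃ κ : ℝ, 0 < κ ∧ ∀ ρ : ℝ, 0 < ρ →
        ∃ s r z : ℝ, -ρ ^ 2 < s ∧ s < 0 ∧ 0 < r ∧ r < ρ ∧ |z| < ρ ∧
          κ ≤ circ (fun t x => L (w t (L.symm x))) r z s := by
  obtain ⟨L, hL, hdet⟩ := exists_bisectorFrame hline
  refine ⟨L, hdet, hL, ?_⟩
  have h := not_isBackwardSingularPoint_of_fluxDecay_bisectorFrame hrate hcont hmild hdiv he3 he hline L hdet hL
  by_contra hcon
  refine h (fun κ hκ => ?_) hsing
  by_contra hρ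
  refine hcon ⟨κ, hκ, fun ρ hρ' => ?_⟩
  by_contra hwin
  refine hρ ⟨ρ, hρ', fun s r z h1 h2 h3 h4 h5 => ?_⟩
  by_contra hlt
  exact hwin ⟨s, r, z, h1, h2, h3, h4, h5, not_lt.1 hlt⟩

end Summit.NavierStokesRegularity.NavierStokesRegularity.Theorems.AxisTwistDoorSignConeBisectorFrame

end
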